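import Mathlib
import Summits.ValiantsHypothesis.ValiantsHypothesis.Theorems.BarrierLeverPartitionMinorsHitByVPHiddenStatesHubJoinsAxis

/-!
# Route BarrierLever — item `PartitionMinorsHitByVP` (stmt-ValiantsHypothesis-19717), line `hidden-states`,
# stub `stub_qjoinSharp` (Q_join(h²)): the AXIS TABLE on the hub-join design — structured columns are independent

Helper file (`--supports stmt-ValiantsHypothesis-19717`; cell valiant-natproofs, rung V4, 𝒟-side door (c); prover seat
val-np-p8 gen 3, lane `stub_qjoinSharp`). Bookkeeping defs (`cyPt`, `mate`, `θat`, `axisTab`, `coreA`, `baseSat`, `derived`,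
`priv`); closes NO item. Part 2 of 3 of the axis-table development (tools: `…HubJoinsAxis`; theorem: `…HubJoinsAxisGood`).

THE AXIS TABLE (`axisTab`, coordinate `y`, column parameters `θ`) for the hub-join design `HubJoin.hubE`: base of piece `p` ↦
the curve point `c_y(θ base)` with `y`-coordinate `0` (`cyPt`), hub state ↦ `e_y`, satellite `{q}` ↦ `c_y(θ sat) − c_y(θ base)`.
So (`jpt_axisTab`, `jcol_axisTab`) a base/satellite column is the vector `U ↦ [y ∉ U]·θ^{e(U)}` and its translate by `e_y`
(hub / married pair — the DERIVED columns, whose parameter is that of their `mate`) is `U ↦ [y ∉ U] θ^{e(U)} + [y ∈ U] θ^{e(U∖y)}`: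
Hermite data `{ev_z, ev_z ∘ ∂_y}` in two blocks of DISTINCT monomials on the moment curve. If the parameters make
block 0 (rows avoiding `y`, base/satellite columns `baseSat`) and block 1 (rows containing `y`, mates of the derived columns)
independent, ALL structured columns `coreA` are independent (`core_indep`, part 3). The unmarried satellites are private
singletons (`hubE_free`, `hubE_priv`) — free columns for `JoinFilling.exists_table_of_core`.

WHAT THIS IS NOT: no goodness statement yet (part 3); nothing on crux 14610 or VP ≠ VNP.
-/

set_option linter.dupNamespace false

namespace Summit.ValiantsHypothesis.ValiantsHypothesis.Theorems.BarrierLever.HiddenStates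

open Finset Matrix

noncomputable section

namespace HubAxis

open TwoLayer (curveVec)
open JoinFilling (jpt jcol IndepOn det_ne_zero_of_indepOn exists_table_of_core)
open HubJoin (hubStates hubPiece hubE pos_lt hubStates_single hubStates_pair div_mul_add_mod' hubE_injective hub_threshold
  hubW hubWt)

variable {h m K l r : ℕ}

/-! ## 1. Curve points with one coordinate switched off -/

/-- The curve point `(s^{2^a})_a` with its `y`-coordinate replaced by `0`. -/
def cyPt (y : Fin h) (s : ℂ) (a : Fin h) : ℂ := if a = y then 0 else s ^ (2 ^ (a : ℕ))

/-- Rows containing `y` vanish on the switched-off curve point; the others see the monomial `s^{e(U)}`. -/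
theorem prod_cyPt (y : Fin h) (s : ℂ) (U : Finset (Fin h)) :
    ∏ a ∈ U, cyPt y s a = if y ∈ U then 0 else s ^ (∑ a ∈ U, 2 ^ (a : ℕ)) := by
  by_cases hy : y ∈ U
  · rw [if_pos hy]
    exact Finset.prod_eq_zero hy (by simp [cyPt])
  · rw [if_neg hy, ← Finset.prod_pow_eq_pow_sum]
    refine Finset.prod_congr rfl fun a ha => ?_
    have : a ≠ y := fun h' => hy (h' ▸ ha)
    simp [cyPt, this]

/-- The translated point `c_y(s) + e_y`: rows containing `y` see `s^{e(U∖y)}`, the others `s^{e(U)}`. -/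
theorem prod_cyPt_add_axis (y : Fin h) (s : ℂ) (U : Finset (Fin h)) :
    ∏ a ∈ U, (cyPt y s a + if a = y then 1 else 0) =
      if y ∈ U then s ^ (∑ a ∈ U.erase y, 2 ^ (a : ℕ)) else s ^ (∑ a ∈ U, 2 ^ (a : ℕ)) := by
  have hoff : ∀ a, a ≠ y → (cyPt y s a + if a = y then 1 else 0) = s ^ (2 ^ (a : ℕ)) := fun a ha => by
    simp [cyPt, ha]
  by_cases hy : y ∈ U
  · rw [if_pos hy, ← Finset.insert_erase hy, Finset.prod_insert (Finset.notMem_erase y U), Finset.erase_insert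
      (Finset.notMem_erase y U)]
    have hyy : (cyPt y s y + if y = y then 1 else 0) = 1 := by simp [cyPt]
    rw [hyy, one_mul, ← Finset.prod_pow_eq_pow_sum]
    exact Finset.prod_congr rfl fun a ha => hoff a (Finset.ne_of_mem_erase ha)
  · rw [if_neg hy, ← Finset.prod_pow_eq_pow_sum]
    exact Finset.prod_congr rfl fun a ha => hoff a (fun h' => hy (h' ▸ ha))

/-! ## 2. The axis table on the hub-join design -/

/-- The MATE of a column: the base for the hub, the satellite `{i}` for the married pair `{0,i}`, itself otherwise. -/
def mate (hl : l + 1 ≤ K) (k : Fin r) : Fin r :=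
  if (k : ℕ) % (K + 1 + l) = 1 then ⟨(k : ℕ) - 1, by omega⟩
  else if K < (k : ℕ) % (K + 1 + l) then ⟨(k : ℕ) + 1 - K, by omega⟩ else k

/-- Parameter of the column with absolute index `t` (zero beyond `r`). -/
def θat (θ : Fin r → ℂ) (t : ℕ) : ℂ := if ht : t < r then θ ⟨t, ht⟩ else 0

/-- The parameter below `r` is the column's parameter. -/
theorem θat_eq (θ : Fin r → ℂ) (t : ℕ) (ht : t < r) : θat θ t = θ ⟨t, ht⟩ := by simp [θat, ht]

/-- **The axis table**: base ↦ `c_y(θ base)`, hub state ↦ `e_y`, satellite `q ≥ 1` ↦ `c_y(θ {q}) − c_y(θ base)`. -/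
def axisTab (K l : ℕ) (y : Fin h) (θ : Fin r → ℂ) (p : Fin m) : Option (Fin K) → Fin h → ℂ
  | none => cyPt y (θat θ ((p : ℕ) * (K + 1 + l)))
  | some q => fun a => if (q : ℕ) = 0 then (if a = y then 1 else 0)
      else cyPt y (θat θ ((p : ℕ) * (K + 1 + l) + q + 1)) a - cyPt y (θat θ ((p : ℕ) * (K + 1 + l))) a

/-- **Column points under the axis table**: column `k` is the point `c_y(θ (mate k))`, translated by `e_y` exactly for the
derived columns (hub, married pairs). -/
theorem jpt_axisTab (hl : l + 1 ≤ K) (hr : r ≤ m * (K + 1 + l)) (y : Fin h) (θ : Fin r → ℂ) (k : Fin r) (a : Fin h) :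
    jpt (axisTab K l y θ) (hubE hl hr k) a =
      cyPt y (θ (mate hl k)) a +
        (if (k : ℕ) % (K + 1 + l) = 1 ∨ K < (k : ℕ) % (K + 1 + l) then (if a = y then 1 else 0) else 0) := by
  have hjB : (k : ℕ) % (K + 1 + l) < K + 1 + l := pos_lt K l k
  have hk : (k : ℕ) / (K + 1 + l) * (K + 1 + l) + (k : ℕ) % (K + 1 + l) = k := div_mul_add_mod' k (K + 1 + l)
  have hkr := k.2
  simp only [jpt, hubE, hubPiece]
  by_cases h0 : (k : ℕ) % (K + 1 + l) = 0
  · -- base column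
    rw [show hubStates hl ((k : ℕ) % (K + 1 + l)) (pos_lt K l k) = ∅ from by simp [hubStates, h0],
      Finset.sum_empty, add_zero]
    have hm : mate hl k = k := by simp [mate, h0]
    rw [if_neg (by omega), add_zero, hm]
    simp only [axisTab]
    rw [θat_eq θ _ (by omega)]
    congr 2
    apply Fin.ext; simp only; omega
  by_cases h1 : (k : ℕ) % (K + 1 + l) = 1
  · -- hub column
    rw [show hubStates hl ((k : ℕ) % (K + 1 + l)) (pos_lt K l k) = {⟨0, by omega⟩} from by
      rw [hubStates_single hl _ _ h0 (by omega)]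
      congr 1; apply Fin.ext; simp [h1], Finset.sum_singleton]
    simp only [axisTab, if_true]
    have hm : mate hl k = ⟨(k : ℕ) - 1, by omega⟩ := by simp [mate, h1]
    rw [if_pos (Or.inl h1), hm, θat_eq θ _ (by omega)]
    congr 3
    apply Fin.ext; simp only; omega
  by_cases hK' : (k : ℕ) % (K + 1 + l) ≤ K
  · -- satellite column
    rw [show hubStates hl ((k : ℕ) % (K + 1 + l)) (pos_lt K l k) = {⟨(k : ℕ) % (K + 1 + l) - 1, by omega⟩} from
      hubStates_single hl _ _ h0 hK', Finset.sum_singleton]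
    simp only [axisTab]
    rw [if_neg (show (k : ℕ) % (K + 1 + l) - 1 ≠ 0 by omega)]
    have hm : mate hl k = k := by simp [mate, h1, not_lt.mpr hK']
    rw [if_neg (by omega), add_zero, hm, add_sub_cancel,
      θat_eq θ _ (by show (k : ℕ) / (K + 1 + l) * (K + 1 + l) + ((k : ℕ) % (K + 1 + l) - 1) + 1 < r; omega)]
    congr 2
    apply Fin.ext
    show (k : ℕ) / (K + 1 + l) * (K + 1 + l) + ((k : ℕ) % (K + 1 + l) - 1) + 1 = k
    omega
  · -- married pair column
    have hKj : K < (k : ℕ) % (K + 1 + l) := not_le.mp hK'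
    rw [show hubStates hl ((k : ℕ) % (K + 1 + l)) (pos_lt K l k) = {⟨0, by omega⟩, ⟨(k : ℕ) % (K + 1 + l) - K, by omega⟩} from
      hubStates_pair hl _ _ hKj]
    rw [Finset.sum_pair (by intro heq; have := congrArg Fin.val heq; simp at this; omega)]
    simp only [axisTab, if_true]
    rw [if_neg (show (k : ℕ) % (K + 1 + l) - K ≠ 0 by omega)]
    have hm : mate hl k = ⟨(k : ℕ) + 1 - K, by omega⟩ := by simp [mate, h1, hKj]
    rw [if_pos (Or.inr hKj), hm, θat_eq θ ((k : ℕ) / (K + 1 + l) * (K + 1 + l) + ((k : ℕ) % (K + 1 + l) - K) + 1) (by omega)]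
    have hidx : (⟨(k : ℕ) / (K + 1 + l) * (K + 1 + l) + ((k : ℕ) % (K + 1 + l) - K) + 1, by omega⟩ : Fin r) =
        ⟨(k : ℕ) + 1 - K, by omega⟩ := by apply Fin.ext; simp only; omega
    rw [hidx]
    ring

/-- **Column vectors under the axis table**: rows avoiding `y` see the monomial `θ^{e(U)}`; rows containing `y` see `0` on a
base/satellite column and `θ^{e(U∖y)}` on a derived column. -/
theorem jcol_axisTab (hl : l + 1 ≤ K) (hr : r ≤ m * (K + 1 + l)) (u : Fin r → Finset (Fin h)) (y : Fin h)
    (θ : Fin r → ℂ) (k i : Fin r) :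
    jcol u (hubE hl hr) (axisTab K l y θ) k i =
      if (k : ℕ) % (K + 1 + l) = 1 ∨ K < (k : ℕ) % (K + 1 + l) then
        (if y ∈ u i then θ (mate hl k) ^ (∑ a ∈ (u i).erase y, 2 ^ (a : ℕ)) else θ (mate hl k) ^ (∑ a ∈ u i, 2 ^ (a : ℕ)))
      else (if y ∈ u i then 0 else θ (mate hl k) ^ (∑ a ∈ u i, 2 ^ (a : ℕ))) := by
  simp only [jcol]
  simp_rw [jpt_axisTab hl hr y θ k]
  by_cases hd : (k : ℕ) % (K + 1 + l) = 1 ∨ K < (k : ℕ) % (K + 1 + l)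
  · simp only [if_pos hd]
    exact prod_cyPt_add_axis y _ (u i)
  · simp only [if_neg hd, add_zero]
    exact prod_cyPt y _ (u i)

/-! ## 3. The structured columns and the private (free) satellites -/

/-- The structured (core) columns: bases, hubs, satellites `{1..l}` and married pairs; the rest are free satellites. -/
def coreA (K l r : ℕ) : Finset (Fin r) :=
  Finset.univ.filter fun k => (k : ℕ) % (K + 1 + l) ≤ l + 1 ∨ K < (k : ℕ) % (K + 1 + l)

/-- Base and low-satellite columns (the columns carrying their own curve parameter). -/
def baseSat (K l r : ℕ) : Finset (Fin r) :=
  Finset.univ.filter fun k => (k : ℕ) % (K + 1 + l) = 0 ∨ (2 ≤ (k : ℕ) % (K + 1 + l) ∧ (k : ℕ) % (K + 1 + l) ≤ l + 1)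

/-- Derived columns: hubs and married pairs. -/
def derived (K l r : ℕ) : Finset (Fin r) :=
  Finset.univ.filter fun k => (k : ℕ) % (K + 1 + l) = 1 ∨ K < (k : ℕ) % (K + 1 + l)

/-- The private state of a free satellite column (positions `l+2..K`). -/
def priv (hl : l + 1 ≤ K) (k : Fin r) : Fin K := ⟨min ((k : ℕ) % (K + 1 + l) - 1) (K - 1), by omega⟩

/-- Membership in the structured columns. -/
theorem mem_coreA {k : Fin r} : k ∈ coreA K l r ↔ ((k : ℕ) % (K + 1 + l) ≤ l + 1 ∨ K < (k : ℕ) % (K + 1 + l)) := by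
  simp [coreA]

/-- Membership in the base/low-satellite columns. -/
theorem mem_baseSat {k : Fin r} :
    k ∈ baseSat K l r ↔ ((k : ℕ) % (K + 1 + l) = 0 ∨ (2 ≤ (k : ℕ) % (K + 1 + l) ∧ (k : ℕ) % (K + 1 + l) ≤ l + 1)) := by
  simp [baseSat]

/-- Membership in the derived columns. -/
theorem mem_derived {k : Fin r} : k ∈ derived K l r ↔ ((k : ℕ) % (K + 1 + l) = 1 ∨ K < (k : ℕ) % (K + 1 + l)) := by
  simp [derived]

/-- A free satellite column is the singleton of its private state. -/
theorem hubE_free (hl : l + 1 ≤ K) (hr : r ≤ m * (K + 1 + l)) (k : Fin r) (hk : k ∉ coreA K l r) :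
    (hubE hl hr k).2 = {priv hl k} := by
  rw [mem_coreA, not_or, not_le, not_lt] at hk
  simp only [hubE]
  rw [hubStates_single hl _ _ (by omega) hk.2]
  congr 1
  apply Fin.ext
  simp only [priv]
  omega

/-- The private state of a free column occurs in no other column of its piece. -/
theorem hubE_priv (hl : l + 1 ≤ K) (hr : r ≤ m * (K + 1 + l)) (k : Fin r) (hk : k ∉ coreA K l r) (k' : Fin r)
    (hp : (hubE hl hr k').1 = (hubE hl hr k).1) (hmem : priv hl k ∈ (hubE hl hr k').2) : k' = k := by
  rw [mem_coreA, not_or, not_le, not_lt] at hk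
  have hkk : (k : ℕ) / (K + 1 + l) * (K + 1 + l) + (k : ℕ) % (K + 1 + l) = k := div_mul_add_mod' k (K + 1 + l)
  have hkk' : (k' : ℕ) / (K + 1 + l) * (K + 1 + l) + (k' : ℕ) % (K + 1 + l) = k' := div_mul_add_mod' k' (K + 1 + l)
  simp only [hubE, hubPiece, Fin.mk.injEq] at hp hmem
  have hpv : ((priv hl k : Fin K) : ℕ) = (k : ℕ) % (K + 1 + l) - 1 := by simp only [priv]; omega
  have hjB' := pos_lt K l (k' : ℕ)
  by_cases h0 : (k' : ℕ) % (K + 1 + l) = 0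
  · rw [show hubStates hl ((k' : ℕ) % (K + 1 + l)) (pos_lt K l k') = ∅ from by simp [hubStates, h0]] at hmem
    simp at hmem
  by_cases hK' : (k' : ℕ) % (K + 1 + l) ≤ K
  · rw [hubStates_single hl _ _ h0 hK', Finset.mem_singleton] at hmem
    have := congrArg Fin.val hmem
    rw [hpv] at this
    simp only at this
    apply Fin.ext
    rw [← hkk, ← hkk', hp]
    omega
  · rw [hubStates_pair hl _ _ (not_le.mp hK'), Finset.mem_insert, Finset.mem_singleton] at hmem
    rcases hmem with h' | h'
    · have := congrArg Fin.val h'; rw [hpv] at this; simp at this; omega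
    · have := congrArg Fin.val h'; rw [hpv] at this; simp at this; omega

/-- The mate of a derived column is a base/low-satellite column. -/
theorem mate_mem_baseSat (hl : l + 1 ≤ K) (k : Fin r) (hk : k ∈ derived K l r) : mate hl k ∈ baseSat K l r := by
  rw [mem_derived] at hk
  rw [mem_baseSat]
  have hkk : (k : ℕ) / (K + 1 + l) * (K + 1 + l) + (k : ℕ) % (K + 1 + l) = k := div_mul_add_mod' k (K + 1 + l)
  have hjB := pos_lt K l (k : ℕ)
  rcases hk with h1 | hK
  · have hm : ((mate hl k : Fin r) : ℕ) = k - 1 := by simp [mate, h1]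
    left
    rw [hm]
    have : (k : ℕ) - 1 = (k : ℕ) / (K + 1 + l) * (K + 1 + l) + 0 := by omega
    rw [this, Nat.add_mod, Nat.mul_mod_left]; simp
  · have h1 : (k : ℕ) % (K + 1 + l) ≠ 1 := by omega
    have hm : ((mate hl k : Fin r) : ℕ) = k + 1 - K := by simp [mate, h1, hK]
    right
    rw [hm]
    have heq : (k : ℕ) + 1 - K = (k : ℕ) / (K + 1 + l) * (K + 1 + l) + ((k : ℕ) % (K + 1 + l) + 1 - K) := by omega
    have hmod : ((k : ℕ) + 1 - K) % (K + 1 + l) = (k : ℕ) % (K + 1 + l) + 1 - K := by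
      rw [heq, Nat.add_mod, Nat.mul_mod_left, zero_add, Nat.mod_mod, Nat.mod_eq_of_lt (by omega)]
    rw [hmod]
    omega

/-- The mate map is injective on derived columns. -/
theorem mate_injOn (hl : l + 1 ≤ K) : Set.InjOn (mate hl : Fin r → Fin r) (derived K l r) := by
  intro k hk k' hk' hmm
  rw [Finset.mem_coe, mem_derived] at hk hk'
  have hkk : (k : ℕ) / (K + 1 + l) * (K + 1 + l) + (k : ℕ) % (K + 1 + l) = k := div_mul_add_mod' k (K + 1 + l)
  have hkk' : (k' : ℕ) / (K + 1 + l) * (K + 1 + l) + (k' : ℕ) % (K + 1 + l) = k' := div_mul_add_mod' k' (K + 1 + l)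
  have hjB := pos_lt K l (k : ℕ)
  have hjB' := pos_lt K l (k' : ℕ)
  have hv := congrArg Fin.val hmm
  -- values of the mates and their residues
  have key : ∀ (x : Fin r), ((x : ℕ) % (K + 1 + l) = 1 ∨ K < (x : ℕ) % (K + 1 + l)) →
      (((mate hl x : Fin r) : ℕ) = x - 1 ∧ ((x : ℕ) - 1) % (K + 1 + l) = 0 ∧ (x : ℕ) % (K + 1 + l) = 1) ∨
      (((mate hl x : Fin r) : ℕ) = x + 1 - K ∧ ((x : ℕ) + 1 - K) % (K + 1 + l) = (x : ℕ) % (K + 1 + l) + 1 - K ∧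
        K < (x : ℕ) % (K + 1 + l)) := by
    intro x hx
    have hxx : (x : ℕ) / (K + 1 + l) * (K + 1 + l) + (x : ℕ) % (K + 1 + l) = x := div_mul_add_mod' x (K + 1 + l)
    have hxB := pos_lt K l (x : ℕ)
    rcases hx with h1 | hK
    · left
      refine ⟨by simp [mate, h1], ?_, h1⟩
      have : (x : ℕ) - 1 = (x : ℕ) / (K + 1 + l) * (K + 1 + l) + 0 := by omega
      rw [this, Nat.add_mod, Nat.mul_mod_left]; simp
    · right
      have h1 : (x : ℕ) % (K + 1 + l) ≠ 1 := by omega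
      refine ⟨by simp [mate, h1, hK], ?_, hK⟩
      have heq : (x : ℕ) + 1 - K = (x : ℕ) / (K + 1 + l) * (K + 1 + l) + ((x : ℕ) % (K + 1 + l) + 1 - K) := by omega
      rw [heq, Nat.add_mod, Nat.mul_mod_left, zero_add, Nat.mod_mod, Nat.mod_eq_of_lt (by omega)]
  apply Fin.ext
  rcases key k hk with ⟨hm, hres, h1⟩ | ⟨hm, hres, hK⟩ <;> rcases key k' hk' with ⟨hm', hres', h1'⟩ | ⟨hm', hres', hK1'⟩
  · rw [hm, hm'] at hv; omega
  · rw [hm, hm'] at hv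
    have := congrArg (· % (K + 1 + l)) hv; simp only [hres, hres'] at this; omega
  · rw [hm, hm'] at hv
    have := congrArg (· % (K + 1 + l)) hv; simp only [hres, hres'] at this; omega
  · rw [hm, hm'] at hv; omega

end HubAxis

end

end Summit.ValiantsHypothesis.ValiantsHypothesis.Theorems.BarrierLever.HiddenStates
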